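import Mathlib
import HarnessLib
import Summits.KontsevichZagierPeriods.KontsevichZagierPeriods.Theses.FurushoPentagon
import Summits.KontsevichZagierPeriods.KontsevichZagierPeriods.Theorems.FurushoPentagonDoubleShuffleOfPentagon
import Literature.NumberTheory.Transcendental.AssociatorsDoubleShuffleProofs

/-!
# Route FurushoPentagon — the mechanism WITHOUT `ReducedPeriodRing` (branch F1 of the thesis)

`PentagonInKZ → DoubleShuffleInKZ`, unconditionally in the crux `ReducedPeriodRing`
(stmt-KontsevichZagierPeriods-3929).

The route's mechanism was filed as `DoubleShuffleOfPentagon : PentagonInKZ → ReducedPeriodRing →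
DoubleShuffleInKZ` (proved, `doubleShuffleOfPentagon_proof`), the rank-3 crux `ReducedPeriodRing`
(the formal period ring `P = KZ.FormalRep ⧸ KZ.relations` has no nilpotents) being "the exact
algebraic price of running Furusho's field-level theorem over `P_ℚ`". That price is nil: Furusho's
theorem [Furusho2011, Thm 1.2] (pentagon ⇒ generalised double shuffle for group-like series) holds
over EVERY commutative `ℚ`-algebra — the Literature theorem
`furusho_pentagon_doubleShuffle_commRing` (its proof, [Furusho2011, §4–§5] made algebraic, is a
chain of polynomial identities in the coefficients and never divides by a non-constant or uses
reducedness). Hence for a realisation `(R, χ, Z)` of the Kontsevich–Zagier rules one applies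
Furusho's theorem directly in `R` to the `χ`-valued shuffle-regularised multiple zeta series
`Φ_{χ,Z}`, which is group-like by the PROVED item `ShuffleIsDissection`
(`DoubleShuffleOfPentagon.isGroupLike_realisation`) and satisfies Drinfeld's pentagon by
`PentagonInKZ`; no passage through the universal realisation `P_ℚ`, no reducedness, no
`IntegerDivision`. This is exactly the thesis' branch "F1 = FurushoIdealLevel (Pent ∩ GroupLike ⊆
DMR ideal-theoretically over ℚ) ⇒ ReducedPeriodRing leaves the mechanism" (route docstring,
TWO-LAYER PLAN and CHEAPEST FALSIFIER (i)).

References: H. Furusho, *Double shuffle relation for associators*, Ann. of Math. 174 (2011),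
Thm 1.2 [Furusho2011]; K. Ihara, M. Kaneko, D. Zagier, Compos. Math. 142 (2006) [IharaKanekoZagier2006].
-/

noncomputable section

open Literature.NumberTheory.Transcendental
open Literature.NumberTheory.Transcendental.KZ
open Summit.KontsevichZagierPeriods.KontsevichZagierPeriods.Theses.FurushoPentagon

namespace Summit.KontsevichZagierPeriods.FurushoPentagon.DoubleShuffleInKZOfPentagon

/-- **The mechanism of route FurushoPentagon needs no reducedness: `PentagonInKZ →
DoubleShuffleInKZ`.** For every commutative `ℚ`-algebra `R`, every realisation `χ` of the rules
(additive, killing `KZ.relations`, multiplicative, non-degenerate) and every `Z` pinned to the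
simplex classes, the `χ`-valued shuffle-regularised MZV series is group-like
(`DoubleShuffleOfPentagon.isGroupLike_realisation`, from the proved `ShuffleIsDissection`) and
satisfies Drinfeld's pentagon (`PentagonInKZ` at `(R, χ, Z)`), hence the generalised double shuffle
relation by Furusho's theorem over the commutative `ℚ`-algebra `R` itself
(`furusho_pentagon_doubleShuffle_commRing`, [Furusho2011, Thm 1.2]). [cite: Furusho2011, Thm 1.2] -/
theorem doubleShuffleInKZ_of_pentagonInKZ : PentagonInKZ → DoubleShuffleInKZ := by
  unfold PentagonInKZ DoubleShuffleInKZ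
  intro hP R _ _ χ hrel hmul hunit Z hZ
  exact furusho_pentagon_doubleShuffle_commRing R _
    (DoubleShuffleOfPentagon.isGroupLike_realisation R χ hrel hmul hunit Z hZ)
    (hP R χ hrel hmul hunit Z hZ)

/-- **`DoubleShuffleOfPentagon` with its `ReducedPeriodRing` hypothesis idle**: the filed mechanism
item `PentagonInKZ → ReducedPeriodRing → DoubleShuffleInKZ` follows from
`doubleShuffleInKZ_of_pentagonInKZ` by discarding the reducedness hypothesis — recorded to make the
idleness of the crux in the mechanism kernel-visible. [cite: Furusho2011, Thm 1.2] -/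
theorem doubleShuffleOfPentagon_of_unconditional : DoubleShuffleOfPentagon :=
  fun hP _ => doubleShuffleInKZ_of_pentagonInKZ hP

end Summit.KontsevichZagierPeriods.FurushoPentagon.DoubleShuffleInKZOfPentagon

end
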